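import Literature.Geometry.Riemannian.VectorFieldBochnerFormula
import Literature.Geometry.Riemannian.EigenvaluePinchingSphereProofs
import Literature.Geometry.Lorentzian.TrilinearNormSq
import HarnessLib

/-!
# `div(Ric(∇w, ·)♯ − ½R∇w) = ⟨Ric, Hess w⟩ − ½RΔw`, and the weak contracted Bianchi identity
# `∫ ⟨Ric − ½R g, Hess w⟩ dμ = 0` on a closed Riemannian manifold

For a smooth pseudo-Riemannian metric `g` with its Levi-Civita connection `∇` (`LeviCivita.lean`),
its Ricci tensor `Ric` and scalar curvature `R`, the divergence `div Y = tr ∇Y` of vector fields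
(`PseudoRiemannianMetric.vectorDivergence`, `DivergenceTheorem.lean`), the Hessian
`Hess w = ∇dw`, the Laplace–Beltrami operator `Δ_g w = tr_g Hess w` (`dalembertian`) and the
metric pairing of bilinear forms `⟨S, S'⟩_g` (`innerBilin`, `TrilinearNormSq.lean`), we PROVE:

* coordinates (`MetricCoord`, for metric components `G` smooth, symmetric and nondegenerate on an
  open set, continuing `CoordDivergenceIdentity.lean` / `CoordBianchi.lean`):
  `IsMetricOn.covDAt_sharpAt_apply` — **`∇_X(♯θ) = ♯(∇_X θ)`** for a field of one-forms `θ`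
  (index raising commutes with `∇`); `IsMetricOn.covDAt_gradAt`, `IsMetricOn.divAt_gradAt` —
  `∇ grad f = ♯ ∘ Hess f`, `div grad f = Δf`; `IsMetricOn.divAt_sharpAt_ricAt_gradAt` —
  **`div(Ric(grad f, ·)♯) = ½ dS(grad f) + tr_G(Ric ∘ ♯ ∘ Hess f)`**, the first-order term being
  `g^{kl} Ric_{Yl;k} = ½ S_{;Y}`, THE CONTRACTED BIANCHI IDENTITY `IsMetricOn.fderiv_scalAt`
  (O'Neill 1983, Ch. 3, Cor. 3.54); `IsMetricOn.divAt_ricciHessianField` —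
  **`div(Ric(grad f, ·)♯ − ½ S grad f) = tr_G(Ric ∘ ♯ ∘ Hess f) − ½ S Δf`** (no derivative of the
  curvature survives: `div(Ric − ½ S g) = 0`);
* manifold (transport through the chart at the point, as in `VectorFieldBochnerFormula.lean`:
  `vectorRep_sharp_mvfderiv`, `vectorRep_sharp_ricci_sharp_mvfderiv`,
  `vectorRep_ricciHessianField`, `contMDiffAt_ricciHessianField` (the field
  `Ric(∇w, ·)♯ − ½R∇w` of a smooth `w` is a smooth vector field),
  `trace_ricci_sharp_hessian_chartInv_eq`): `vectorDivergence_ricciHessianField` —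
  **`div_g(Ric(∇w, ·)♯ − ½R∇w) = tr_g(Ric ∘ ♯ ∘ Hess w) − ½ R Δ_g w`** at every point, and
  `trace_ricci_sharp_hessian_eq_innerBilin` — `tr_g(Ric ∘ ♯ ∘ Hess w) = ⟨Ric, Hess w⟩_g`;
* closed Riemannian manifolds `(N, h)` modelled on `ℝᵐ` (the divergence theorem
  `integral_vectorDivergence_eq_zero`): `integral_innerBilin_ricci_hessian_sub_eq_zero` —
  **the weak contracted Bianchi identity `∫_N (⟨Ric, Hess w⟩ − ½ R Δ_h w) dμ_h = 0`**, i.e.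
  `∫ ⟨Ric − ½Rh, Hess w⟩ dμ_h = 0` for every smooth `w` (the Einstein tensor is divergence free,
  integrated by parts twice), with the continuity of `⟨Ric, Hess w⟩`;
  `integral_two_mul_innerBilin_ricci_hessian_sub_eq_zero` (`∫(2⟨Ric, Hess w⟩ − RΔw) = 0`, the
  hypothesis `hBianchi` of `sigma2WeylSchoutenIntegral_conformal_exp_of_bianchiPairing`,
  `Sigma2ConformalFour.lean`, which makes the conformal invariance of `∫σ₂(A_g) dV_g` on closed
  `4`-manifolds — Chang–Gursky–Yang 2003, p. 111 — unconditional) and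
  `integral_innerBilin_ricci_hessian_eq` (`∫⟨Ric, Hess w⟩ = ½∫RΔw`).

Everything is proved; no definition and no statement of `Prop` type is introduced (the field
`Ric(∇w, ·)♯ − ½R∇w` is written out).

## References

* B. O'Neill, *Semi-Riemannian geometry with applications to relativity*, Academic Press 1983,
  Ch. 3: Prop. 3.13 (coordinate formula for `D`), p. 60 (`♯`), p. 86 (divergence; contraction
  commutes with `∇`), Lemma 3.49–Def. 3.50 (Hessian, Laplacian), Cor. 3.54 (`dS = 2 div Ric`,
  `div(Ric − ½ S g) = 0`), Prop. 3.59 (local isometries). [ONeill1983]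
* P. Topping, *Lectures on the Ricci flow*, LMS Lecture Note Series 325, CUP 2006, (2.1.9)
  (`δ Ric + ½ dR = 0`). [Topping2006]
* S.-Y. A. Chang, M. J. Gursky, P. C. Yang, *A conformally invariant sphere theorem in four
  dimensions*, Publ. Math. IHÉS 98 (2003) 105–143, §1, p. 111 (conformal invariance of
  `∫σ₂(A) dvol`, the application). [ChangGurskyYang2003]
-/

noncomputable section

set_option maxSynthPendingDepth 3

open Bundle Set Function Filter FiberBundle VectorField ContinuousLinearMap TopologicalSpace MeasureTheory
open scoped Manifold ContDiff Topology

/-! ### The coordinate identities -/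

namespace Literature.Geometry.Lorentzian.MetricCoord

variable {E : Type*} [NormedAddCommGroup E] [NormedSpace ℝ E] [FiniteDimensional ℝ E]
  [CompleteSpace E] {G : E → E →L[ℝ] E →L[ℝ] ℝ} {V : Set E} {x : E}

omit [FiniteDimensional ℝ E] in
/-- **The covariant differential of a raised one-form**: for a field of one-forms `θ`
differentiable at `x`, `∇_X (♯θ) = ♯(∂_X θ − θ ∘ Γ_X) = ♯(∇_X θ)` — index raising commutes with
covariant differentiation (metric compatibility `∂_X G = G ∘ Γ_X + (Gᵗ ∘ Γ_X)ᵗ` and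
`∂_X ♯ = −♯ ∘ ∂_X G ∘ ♯`). O'Neill 1983, Ch. 3, Prop. 3.13 and p. 86. [cite: ONeill1983, Ch. 3, p. 86] -/
theorem IsMetricOn.covDAt_sharpAt_apply (hG : IsMetricOn G V) (hx : x ∈ V) {θ : E → E →L[ℝ] ℝ}
    (hθ : DifferentiableAt ℝ θ x) (X : E) :
    covDAt G (fun y ↦ sharpAt G y (θ y)) x X =
      sharpAt G x (fderiv ℝ θ x X - (θ x).comp (chrAt G x X)) := by
  have hi := hG.isInvertible x hx
  rw [hG.covDAt_apply_eq hx]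
  have hd : fderiv ℝ (fun y ↦ sharpAt G y (θ y)) x X =
      sharpAt G x (fderiv ℝ θ x X) + fderiv ℝ (sharpAt G) x X (θ x) := by
    rw [fderiv_clm_apply (hG.differentiableAt_sharpAt hx) hθ]
    rfl
  have hs : fderiv ℝ (sharpAt G) x X (θ x) =
      -(chrAt G x X (sharpAt G x (θ x))) - sharpAt G x ((θ x).comp (chrAt G x X)) := by
    rw [hG.fderiv_sharpAt hx X]
    have hflip : ((G x).flip.comp (chrAt G x X)).flip (sharpAt G x (θ x)) =
        (θ x).comp (chrAt G x X) := by
      ext w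
      simp only [ContinuousLinearMap.flip_apply, ContinuousLinearMap.comp_apply]
      exact apply_sharpAt_apply hi (θ x) _
    simp only [_root_.neg_apply, ContinuousLinearMap.comp_apply]
    rw [hG.fderiv_eq_comp_chrAt hx X, _root_.add_apply, map_add, hflip,
      ContinuousLinearMap.comp_apply, sharpAt_apply hi]
    abel
  rw [hd, hs, map_sub]
  abel

omit [FiniteDimensional ℝ E] in
/-- **`∇(grad f) = ♯ ∘ Hess f`**: the covariant differential of the coordinate gradient
`y ↦ ♯_y Df(y)` is the index raising of the coordinate Hessian (O'Neill 1983, Ch. 3,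
Def. 3.48–3.50: `Hess f = ∇(df)`, `grad f = ♯ df`). [cite: ONeill1983, Ch. 3, Lemma 3.49] -/
theorem IsMetricOn.covDAt_gradAt (hG : IsMetricOn G V) (hx : x ∈ V) {f : E → ℝ}
    (hf : DifferentiableAt ℝ (fderiv ℝ f) x) :
    covDAt G (fun y ↦ sharpAt G y (fderiv ℝ f y)) x = (sharpAt G x).comp (hessAt G f x) := by
  ext X
  rw [hG.covDAt_sharpAt_apply hx hf X, ContinuousLinearMap.comp_apply]
  rfl

/-- **`div(grad f) = Δf` in coordinates**: `divAt G (♯ Df) x = lapAt G f x`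
(O'Neill 1983, Ch. 3, Def. 3.50: `Δf = div grad f`). [cite: ONeill1983, Ch. 3, Def. 3.50] -/
theorem IsMetricOn.divAt_gradAt (hG : IsMetricOn G V) (hx : x ∈ V) {f : E → ℝ}
    (hf : DifferentiableAt ℝ (fderiv ℝ f) x) :
    divAt G (fun y ↦ sharpAt G y (fderiv ℝ f y)) x = lapAt G f x := by
  rw [divAt_eq, hG.covDAt_gradAt hx hf, ← mtrAt_eq_traceCLM]
  rfl

/-- **`div (Ric(grad f, ·)♯) = ½ dS(grad f) + ⟨Ric, Hess f⟩` in coordinates.** For metric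
components `G` (smooth, symmetric, nondegenerate near `x`) and `f` with `Df` differentiable at `x`,
the vector field `y ↦ ♯_y (Ric_y(♯_y Df(y), ·))` has divergence
`½ ∂_{grad f} S + tr_G (Ric ∘ ♯ ∘ Hess f)` at `x`: by `covDAt_sharpAt_apply` its covariant
differential is `♯ ∘ [(X, Y) ↦ (∇_X Ric)(grad f, Y) + Ric(∇_X grad f, Y)]`, the metric trace of the
first form is `g^{kl} Ric_{Yl;k}(grad f) = ½ dS(grad f)` by the contracted Bianchi identity
(`IsMetricOn.fderiv_scalAt`, O'Neill 1983, Ch. 3, Cor. 3.54), and `∇ grad f = ♯ ∘ Hess f`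
(`covDAt_gradAt`). [cite: ONeill1983, Ch. 3, Cor. 3.54] -/
theorem IsMetricOn.divAt_sharpAt_ricAt_gradAt (hG : IsMetricOn G V) (hx : x ∈ V) {f : E → ℝ}
    (hf : DifferentiableAt ℝ (fderiv ℝ f) x) :
    divAt G (fun y ↦ sharpAt G y (ricAt G y (sharpAt G y (fderiv ℝ f y)))) x =
      1 / 2 * fderiv ℝ (scalAt G) x (sharpAt G x (fderiv ℝ f x)) +
        mtrAt G x ((ricAt G x).comp ((sharpAt G x).comp (hessAt G f x))) := by
  have hi := hG.isInvertible x hx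
  set v : E → E := fun y ↦ sharpAt G y (fderiv ℝ f y) with hv
  have hvd : DifferentiableAt ℝ v x := (hG.differentiableAt_sharpAt hx).clm_apply hf
  have hωd : DifferentiableAt ℝ (fun y ↦ ricAt G y (v y)) x :=
    (hG.differentiableAt_ricAt hx).clm_apply hvd
  -- the covariant differential of the field
  have hcov : covDAt G (fun y ↦ sharpAt G y (ricAt G y (v y))) x =
      (sharpAt G x).comp ((cov₂At G (ricAt G) x).flip (v x) +
        (ricAt G x).comp ((sharpAt G x).comp (hessAt G f x))) := by
    ext X
    rw [hG.covDAt_sharpAt_apply hx hωd X, ContinuousLinearMap.comp_apply]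
    congr 1
    rw [← hG.covDAt_gradAt hx hf, fderiv_clm_apply (hG.differentiableAt_ricAt hx) hvd]
    ext Y
    simp only [_root_.sub_apply, _root_.add_apply,
      ContinuousLinearMap.comp_apply, ContinuousLinearMap.flip_apply, cov₂At_apply,
      hG.covDAt_apply_eq hx]
    rw [map_add, _root_.add_apply]
    ring
  -- the trace of the Bianchi part
  set b := Module.finBasis ℝ E with hb
  have hB : mtrAt G x ((cov₂At G (ricAt G) x).flip (v x)) =
      1 / 2 * fderiv ℝ (scalAt G) x (v x) := by
    rw [hG.fderiv_scalAt b hx (v x), mtrAt_eq_sum b]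
    simp only [ContinuousLinearMap.flip_apply]
    ring
  rw [divAt_eq, hcov, ← mtrAt_eq_traceCLM, mtrAt_add, hB]

/-- **`div(Ric(grad f, ·)♯ − ½ S grad f) = ⟨Ric, Hess f⟩ − ½ S Δf` in coordinates**: the
divergence of the "Einstein–Hessian field" has no first-order term in the curvature, by the
contracted Bianchi identity `dS = 2 div Ric` (`divAt_sharpAt_ricAt_gradAt`, `divAt_smul`,
`divAt_gradAt`). O'Neill 1983, Ch. 3, Cor. 3.54 (`div(Ric − ½ S g) = 0`).
[cite: ONeill1983, Ch. 3, Cor. 3.54] -/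
theorem IsMetricOn.divAt_ricciHessianField (hG : IsMetricOn G V) (hx : x ∈ V) {f : E → ℝ}
    (hf : DifferentiableAt ℝ (fderiv ℝ f) x) :
    divAt G (fun y ↦ sharpAt G y (ricAt G y (sharpAt G y (fderiv ℝ f y)))
      - (1 / 2 * scalAt G y) • sharpAt G y (fderiv ℝ f y)) x =
      mtrAt G x ((ricAt G x).comp ((sharpAt G x).comp (hessAt G f x)))
        - 1 / 2 * scalAt G x * lapAt G f x := by
  have hvd : DifferentiableAt ℝ (fun y ↦ sharpAt G y (fderiv ℝ f y)) x :=
    (hG.differentiableAt_sharpAt hx).clm_apply hf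
  have hωd : DifferentiableAt ℝ (fun y ↦ ricAt G y (sharpAt G y (fderiv ℝ f y))) x :=
    (hG.differentiableAt_ricAt hx).clm_apply hvd
  have hZd : DifferentiableAt ℝ (fun y ↦ sharpAt G y (ricAt G y (sharpAt G y (fderiv ℝ f y)))) x :=
    (hG.differentiableAt_sharpAt hx).clm_apply hωd
  have hSd : DifferentiableAt ℝ (scalAt G) x :=
    (hG.contDiffOn_scalAt.contDiffAt (hG.mem_nhds hx)).differentiableAt (by simp)
  have hψd : DifferentiableAt ℝ (fun y ↦ 1 / 2 * scalAt G y) x := hSd.const_mul _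
  have hψ' : fderiv ℝ (fun y ↦ 1 / 2 * scalAt G y) x = (1 / 2 : ℝ) • fderiv ℝ (scalAt G) x :=
    fderiv_const_mul hSd _
  have hUd : DifferentiableAt ℝ (fun y ↦ (1 / 2 * scalAt G y) • sharpAt G y (fderiv ℝ f y)) x :=
    hψd.smul hvd
  rw [divAt_sub hZd hUd, divAt_smul hψd hvd, hG.divAt_sharpAt_ricAt_gradAt hx hf,
    hG.divAt_gradAt hx hf, hψ', _root_.smul_apply, smul_eq_mul]
  ring

end Literature.Geometry.Lorentzian.MetricCoord


/-! ### Reading the field `Ric(∇w, ·)♯ − ½R∇w` and the pairing `tr(Ric ∘ ♯ ∘ Hess w)` in a chart -/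

namespace Literature.Geometry.Riemannian

open Lorentzian Lorentzian.OpensChart Lorentzian.PseudoRiemannianMetric Lorentzian.MetricCoord

section Chart

variable {E : Type*} [NormedAddCommGroup E] [NormedSpace ℝ E] {H : Type*} [TopologicalSpace H]
  {I : ModelWithCorners ℝ E H} [I.Boundaryless] {M : Type*} [TopologicalSpace M]
  [ChartedSpace H M] [IsManifold I ∞ M] [FiniteDimensional ℝ E] [CompleteSpace E]
  (g : PseudoRiemannianMetric I ∞ E (TangentSpace I : M → Type _)) [g.HasLeviCivita]

omit [CompleteSpace E] [g.HasLeviCivita] in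
/-- **The gradient read in the chart**: the representative of `y ↦ ♯_g dw_y` at `u` is the
coordinate gradient `♯_{Ĝ(u)} Dŵ(u)`, `ŵ = w ∘ φ⁻¹` (`mfderiv_chartInv_sharpAt_eq`).
[cite: ONeill1983, Ch. 3, p. 60 and Prop. 3.59] -/
theorem vectorRep_sharp_mvfderiv (x₁ : M) {w : M → ℝ} (u : chartTarget I x₁)
    (hw : MDiffAt w (chartInv I x₁ u)) :
    vectorRep I x₁ (fun y ↦ (g.sharp y (mvfderiv I w y : TangentSpace I y →ₗ[ℝ] ℝ) :
      TangentSpace I y)) u =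
      sharpAt (metricRep I g x₁) u (fderiv ℝ (w ∘ (extChartAt I x₁).symm) u) := by
  have hinv : (mfderiv 𝓘(ℝ, E) I (chartInv I x₁) u).IsInvertible :=
    isInvertible_mfderiv_of_injective rfl (injective_mfderiv_chartInv x₁ u)
  rw [← mpullback_chartInv_apply, mpullback_apply, ← mfderiv_chartInv_sharpAt_eq g x₁ u hw]
  exact hinv.inverse_apply_self _

/-- **The field `Ric(∇w, ·)♯` read in the chart**: the representative of
`y ↦ ♯_g (Ric_g(♯_g dw, ·))` at `u` is `♯_Ĝ (Ric_Ĝ(♯_Ĝ Dŵ, ·))(u)` (naturality of `♯` and of the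
Ricci tensor under the local isometry `Φ = chartInv`, `sharp_comap_mfderiv_apply`,
`ricci_comap_apply`, and the chart dictionary `OpensChart.sharp_eq_sharpAt`,
`OpensChart.ricci_eq_ricAt`). [cite: ONeill1983, Ch. 3, Prop. 3.59] -/
theorem vectorRep_sharp_ricci_sharp_mvfderiv (x₁ : M) {w : M → ℝ} (u : chartTarget I x₁)
    (hw : MDiffAt w (chartInv I x₁ u)) :
    vectorRep I x₁ (fun y ↦ (g.sharp y (g.ricci y
      (g.sharp y (mvfderiv I w y : TangentSpace I y →ₗ[ℝ] ℝ))) : TangentSpace I y)) u =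
      sharpAt (metricRep I g x₁) u (ricAt (metricRep I g x₁) u
        (sharpAt (metricRep I g x₁) u (fderiv ℝ (w ∘ (extChartAt I x₁).symm) u))) := by
  haveI := (chartPullback I g x₁).hasLeviCivita
  have hG := val_chartPullback_eq_metricRep g x₁
  have hinv : (mfderiv 𝓘(ℝ, E) I (chartInv I x₁) u).IsInvertible :=
    isInvertible_mfderiv_of_injective rfl (injective_mfderiv_chartInv x₁ u)
  set β : Module.Dual ℝ (TangentSpace I (chartInv I x₁ u)) := g.ricci (chartInv I x₁ u)
    (g.sharp (chartInv I x₁ u) (mvfderiv I w (chartInv I x₁ u) :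
      TangentSpace I (chartInv I x₁ u) →ₗ[ℝ] ℝ)) with hβ
  set α : E →L[ℝ] ℝ := ricAt (metricRep I g x₁) u
    (sharpAt (metricRep I g x₁) u (fderiv ℝ (w ∘ (extChartAt I x₁).symm) u)) with hα
  -- `α = β ∘ dΦ_u`
  have hαβ : (α : E →ₗ[ℝ] ℝ) = β ∘ₗ (mfderiv 𝓘(ℝ, E) I (chartInv I x₁) u).toLinearMap := by
    refine LinearMap.ext fun v ↦ ?_
    change α v = β (mfderiv 𝓘(ℝ, E) I (chartInv I x₁) u v)
    rw [hα, hβ, ← OpensChart.ricci_eq_ricAt hG u, g.ricci_comap_apply contMDiff_pullbackBilin_holds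
        (contMDiff_chartInv x₁) (injective_mfderiv_chartInv x₁) rfl u,
      mfderiv_chartInv_sharpAt_eq g x₁ u hw]
  -- `dΦ_u (♯_Ĝ α) = ♯_g β`
  have hkey : mfderiv 𝓘(ℝ, E) I (chartInv I x₁) u (sharpAt (metricRep I g x₁) u α) =
      g.sharp (chartInv I x₁ u) β := by
    rw [← OpensChart.sharp_eq_sharpAt hG u α, hαβ,
      g.sharp_comap_mfderiv_apply contMDiff_pullbackBilin_holds (contMDiff_chartInv x₁)
        (injective_mfderiv_chartInv x₁) rfl u β]
    exact mfderiv_mfderivEquivOfInjective_symm (I := I) (I' := 𝓘(ℝ, E)) (chartInv I x₁) u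
      (injective_mfderiv_chartInv x₁ u) rfl _
  rw [← mpullback_chartInv_apply, mpullback_apply, ← hkey]
  exact hinv.inverse_apply_self _

/-- **The field `Ric(∇w, ·)♯ − ½R∇w` read in the chart**: its representative at `u` is
`♯_Ĝ(Ric_Ĝ(♯_Ĝ Dŵ, ·)) − ½ S_Ĝ ♯_Ĝ Dŵ` evaluated at `u` (`vectorRep_sharp_ricci_sharp_mvfderiv`,
`vectorRep_sharp_mvfderiv`, `scalarCurvature_eq_scalAt_metricRep`). [folklore] -/
theorem vectorRep_ricciHessianField (x₁ : M) {w : M → ℝ} (u : chartTarget I x₁)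
    (hw : MDiffAt w (chartInv I x₁ u)) :
    vectorRep I x₁ (fun y ↦ (g.sharp y (g.ricci y
        (g.sharp y (mvfderiv I w y : TangentSpace I y →ₗ[ℝ] ℝ))) : TangentSpace I y)
      - (1 / 2 * g.scalarCurvature y) •
        (g.sharp y (mvfderiv I w y : TangentSpace I y →ₗ[ℝ] ℝ) : TangentSpace I y)) u =
      sharpAt (metricRep I g x₁) u (ricAt (metricRep I g x₁) u
          (sharpAt (metricRep I g x₁) u (fderiv ℝ (w ∘ (extChartAt I x₁).symm) u)))
        - (1 / 2 * scalAt (metricRep I g x₁) u) •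
          sharpAt (metricRep I g x₁) u (fderiv ℝ (w ∘ (extChartAt I x₁).symm) u) := by
  rw [← vectorRep_sharp_ricci_sharp_mvfderiv g x₁ u hw, ← vectorRep_sharp_mvfderiv g x₁ u hw,
    ← scalarCurvature_eq_scalAt_metricRep g x₁ u]
  simp only [vectorRep_apply, map_sub, map_smul]
  rfl

set_option maxSynthPendingDepth 2 in
/-- **The field `Ric(∇w, ·)♯ − ½R∇w` of a smooth function is a smooth vector field**: in the chart
at `x` its representative is `♯_Ĝ(Ric_Ĝ(♯_Ĝ Dŵ, ·)) − ½ S_Ĝ ♯_Ĝ Dŵ` (`vectorRep_ricciHessianField`),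
smooth in the smooth data `Ĝ`, `ŵ`. [folklore] -/
theorem contMDiffAt_ricciHessianField {w : M → ℝ} (hw : CMDiff ∞ w) (x : M) :
    CMDiffAt ∞ (T% (fun y ↦ (g.sharp y (g.ricci y
        (g.sharp y (mvfderiv I w y : TangentSpace I y →ₗ[ℝ] ℝ))) : TangentSpace I y)
      - (1 / 2 * g.scalarCurvature y) •
        (g.sharp y (mvfderiv I w y : TangentSpace I y →ₗ[ℝ] ℝ) : TangentSpace I y))) x := by
  set φ := extChartAt I x with hφ
  set c := φ x with hc
  set Ĝ := metricRep I g x with hĜ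
  set wh : E → ℝ := w ∘ (extChartAt I x).symm with hwh
  have hct : c ∈ φ.target := mem_extChartAt_target x
  have hT : φ.target ∈ 𝓝 c := (isOpen_extChartAt_target x).mem_nhds hct
  have hxs : x ∈ (chartAt H x).source := mem_chart_source H x
  have hĜm : IsMetricOn Ĝ φ.target :=
    Lorentzian.OpensChart.isMetricOn_repr (val_chartPullback_eq_metricRep g x)
  -- smoothness of the data at `c`
  have hwrep : ContDiffOn ℝ ∞ wh φ.target := by
    rw [hwh, ← contMDiffOn_iff_contDiffOn]
    exact hw.comp_contMDiffOn (contMDiffOn_extChartAt_symm x)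
  have hwa : ContDiffAt ℝ ∞ wh c := hwrep.contDiffAt hT
  have hDwa : ContDiffAt ℝ ∞ (fderiv ℝ wh) c := hwa.fderiv_right (m := ∞) (by simp)
  have hSa : ContDiffAt ℝ ∞ (sharpAt Ĝ) c := hĜm.contDiffAt_sharpAt hct
  have hRa : ContDiffAt ℝ ∞ (ricAt Ĝ) c := hĜm.contDiffOn_ricAt.contDiffAt hT
  have hsca : ContDiffAt ℝ ∞ (scalAt Ĝ) c := hĜm.contDiffOn_scalAt.contDiffAt hT
  -- the representative and its smoothness at `c`
  set F : E → E := fun e ↦ sharpAt Ĝ e (ricAt Ĝ e (sharpAt Ĝ e (fderiv ℝ wh e)))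
    - (1 / 2 * scalAt Ĝ e) • sharpAt Ĝ e (fderiv ℝ wh e) with hF
  have hva : ContDiffAt ℝ ∞ (fun e ↦ sharpAt Ĝ e (fderiv ℝ wh e)) c := hSa.clm_apply hDwa
  have hFa : ContDiffAt ℝ ∞ F c :=
    (hSa.clm_apply (hRa.clm_apply hva)).sub ((contDiffAt_const.mul hsca).smul hva)
  -- conclude by the chart criterion
  have hYF : ∀ᶠ z in 𝓝 x, vectorRep I x (fun y ↦ (g.sharp y (g.ricci y
        (g.sharp y (mvfderiv I w y : TangentSpace I y →ₗ[ℝ] ℝ))) : TangentSpace I y)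
      - (1 / 2 * g.scalarCurvature y) •
        (g.sharp y (mvfderiv I w y : TangentSpace I y →ₗ[ℝ] ℝ) : TangentSpace I y)) (φ z) =
      F (φ z) := by
    filter_upwards [(chartAt H x).open_source.mem_nhds hxs] with z hz
    have hzt : φ z ∈ φ.target := φ.map_source (by rwa [hφ, _root_.extChartAt_source])
    have hwz : MDiffAt w (chartInv I x ⟨φ z, hzt⟩) := (hw _).mdifferentiableAt (by simp)
    exact vectorRep_ricciHessianField g x ⟨φ z, hzt⟩ hwz
  set e := trivializationAt E (TangentSpace I : M → Type _) x with he
  have hbase : (chartAt H x).source ⊆ e.baseSet := by simp [he]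
  rw [e.contMDiffAt_section_iff (hbase hxs)]
  have h1 : ContMDiffAt I 𝓘(ℝ, E) ∞ (F ∘ φ) x := hFa.contMDiffAt.comp x (contMDiffAt_extChartAt' hxs)
  refine h1.congr_of_eventuallyEq ?_
  filter_upwards [hYF, (chartAt H x).open_source.mem_nhds hxs] with z hz hzs
  rw [Function.comp_apply, ← hz, vectorRep_apply, (extChartAt I x).left_inv
    (by rwa [_root_.extChartAt_source]), ← TangentBundle.continuousLinearMapAt_trivializationAt hzs]
  exact (Trivialization.continuousLinearMapAt_apply_of_mem (R := ℝ) _ (hbase hzs) _).symm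

/-- **The pairing `tr_g(Ric ∘ ♯ ∘ Hess w)` read in the chart**: for `w` of class `C²` at `Φ u`,
`tr_g (Ric_g ∘ ♯_g ∘ Hess_g w)(Φ u) = tr_Ĝ (Ric_Ĝ ∘ ♯_Ĝ ∘ Hess_Ĝ ŵ)(u)` (naturality of the metric
trace, of the Ricci tensor, of `♯` and of the Hessian under the local isometry `Φ`:
`trace_chartPullback_eq`, `ricci_comap_apply`, `sharp_comap_mfderiv_apply`,
`hessian_comap_apply`; then the chart dictionary). [cite: ONeill1983, Ch. 3, Prop. 3.59] -/
theorem trace_ricci_sharp_hessian_chartInv_eq (x₁ : M) (u : chartTarget I x₁) {w : M → ℝ}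
    (hw : CMDiffAt 2 w (chartInv I x₁ u)) :
    g.trace (chartInv I x₁ u) (g.ricci (chartInv I x₁ u) ∘ₗ
      ((g.sharp (chartInv I x₁ u)).toLinearMap ∘ₗ g.hessian w (chartInv I x₁ u))) =
      mtrAt (metricRep I g x₁) u ((ricAt (metricRep I g x₁) u).comp
        ((sharpAt (metricRep I g x₁) u).comp
          (hessAt (metricRep I g x₁) (w ∘ (extChartAt I x₁).symm) u))) := by
  haveI := (chartPullback I g x₁).hasLeviCivita
  have hG := val_chartPullback_eq_metricRep g x₁
  have hrep : ContDiffAt ℝ 2 (w ∘ (extChartAt I x₁).symm) (u : E) := by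
    have hsymm : ContMDiffAt 𝓘(ℝ, E) I 2 (extChartAt I x₁).symm (u : E) :=
      (contMDiffOn_extChartAt_symm x₁).contMDiffAt
        ((isOpen_extChartAt_target x₁).mem_nhds u.2)
    exact contMDiffAt_iff_contDiffAt.1 (hw.comp (u : E) hsymm)
  set eqv := mfderivEquivOfInjective (I := I) (I' := 𝓘(ℝ, E)) (chartInv I x₁) u
    (injective_mfderiv_chartInv x₁ u) rfl with heqv
  -- the pulled-back bilinear form
  set B' : LinearMap.BilinForm ℝ (TangentSpace 𝓘(ℝ, E) u) :=
    (chartPullback I g x₁).ricci u ∘ₗ (((chartPullback I g x₁).sharp u).toLinearMap ∘ₗ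
      (chartPullback I g x₁).hessian (w ∘ chartInv I x₁) u) with hB'
  have hB : ∀ v v', B' v v' = (g.ricci (chartInv I x₁ u) ∘ₗ
      ((g.sharp (chartInv I x₁ u)).toLinearMap ∘ₗ g.hessian w (chartInv I x₁ u)))
        (mfderiv 𝓘(ℝ, E) I (chartInv I x₁) u v) (mfderiv 𝓘(ℝ, E) I (chartInv I x₁) u v') := by
    intro v v'
    have hH : (chartPullback I g x₁).hessian (w ∘ chartInv I x₁) u v =
        g.hessian w (chartInv I x₁ u) (mfderiv 𝓘(ℝ, E) I (chartInv I x₁) u v) ∘ₗ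
          (mfderiv 𝓘(ℝ, E) I (chartInv I x₁) u).toLinearMap :=
      LinearMap.ext fun v'' ↦ g.hessian_comap_apply contMDiff_pullbackBilin_holds
        (contMDiff_chartInv x₁) (injective_mfderiv_chartInv x₁) rfl hw v v''
    have hS : (chartPullback I g x₁).sharp u ((chartPullback I g x₁).hessian (w ∘ chartInv I x₁) u v)
        = eqv.symm (g.sharp (chartInv I x₁ u)
          (g.hessian w (chartInv I x₁ u) (mfderiv 𝓘(ℝ, E) I (chartInv I x₁) u v))) := by
      rw [hH, heqv]
      exact g.sharp_comap_mfderiv_apply contMDiff_pullbackBilin_holds (contMDiff_chartInv x₁)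
        (injective_mfderiv_chartInv x₁) rfl u _
    calc B' v v' = (chartPullback I g x₁).ricci u ((chartPullback I g x₁).sharp u
          ((chartPullback I g x₁).hessian (w ∘ chartInv I x₁) u v)) v' := rfl
      _ = (chartPullback I g x₁).ricci u (eqv.symm (g.sharp (chartInv I x₁ u)
          (g.hessian w (chartInv I x₁ u) (mfderiv 𝓘(ℝ, E) I (chartInv I x₁) u v)))) v' := by
        rw [hS]
      _ = g.ricci (chartInv I x₁ u) (mfderiv 𝓘(ℝ, E) I (chartInv I x₁) u
            (eqv.symm (g.sharp (chartInv I x₁ u)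
              (g.hessian w (chartInv I x₁ u) (mfderiv 𝓘(ℝ, E) I (chartInv I x₁) u v)))))
            (mfderiv 𝓘(ℝ, E) I (chartInv I x₁) u v') :=
        g.ricci_comap_apply contMDiff_pullbackBilin_holds (contMDiff_chartInv x₁)
          (injective_mfderiv_chartInv x₁) rfl u _ _
      _ = g.ricci (chartInv I x₁ u) (g.sharp (chartInv I x₁ u)
            (g.hessian w (chartInv I x₁ u) (mfderiv 𝓘(ℝ, E) I (chartInv I x₁) u v)))
            (mfderiv 𝓘(ℝ, E) I (chartInv I x₁) u v') := by
        rw [heqv, mfderiv_mfderivEquivOfInjective_symm]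
      _ = _ := rfl
  rw [← trace_chartPullback_eq g x₁ u B' _ hB]
  refine OpensChart.trace_eq_mtrAt hG u B' _ fun v v' ↦ ?_
  have hH' : (chartPullback I g x₁).hessian (w ∘ chartInv I x₁) u v =
      ((hessAt (metricRep I g x₁) (w ∘ (extChartAt I x₁).symm) u v : E →L[ℝ] ℝ) :
        E →ₗ[ℝ] ℝ) :=
    LinearMap.ext fun v'' ↦
      OpensChart.hessian_eq_hessAt hG u (f := w ∘ chartInv I x₁) (fun _ ↦ rfl) hrep v v''
  have hS' : (chartPullback I g x₁).sharp u ((chartPullback I g x₁).hessian (w ∘ chartInv I x₁) u v)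
      = sharpAt (metricRep I g x₁) u (hessAt (metricRep I g x₁) (w ∘ (extChartAt I x₁).symm) u v) := by
    rw [hH']
    exact OpensChart.sharp_eq_sharpAt hG u _
  calc B' v v' = (chartPullback I g x₁).ricci u ((chartPullback I g x₁).sharp u
        ((chartPullback I g x₁).hessian (w ∘ chartInv I x₁) u v)) v' := rfl
    _ = (chartPullback I g x₁).ricci u (sharpAt (metricRep I g x₁) u
        (hessAt (metricRep I g x₁) (w ∘ (extChartAt I x₁).symm) u v)) v' := by rw [hS']
    _ = ricAt (metricRep I g x₁) u (sharpAt (metricRep I g x₁) u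
        (hessAt (metricRep I g x₁) (w ∘ (extChartAt I x₁).symm) u v)) v' :=
      OpensChart.ricci_eq_ricAt hG u _ _
    _ = _ := rfl

/-- **`div(Ric(∇w, ·)♯ − ½R∇w) = tr_g(Ric ∘ ♯ ∘ Hess w) − ½RΔ_g w`** on a pseudo-Riemannian
manifold (pointwise; `g` smooth with its Levi-Civita connection, `w ∈ C^∞`). The first-order
curvature terms cancel by the contracted Bianchi identity `dR = 2 div Ric` (O'Neill 1983, Ch. 3,
Cor. 3.54: `div(Ric − ½Rg) = 0`); proof: read everything in the chart at the point
(`vectorRep_ricciHessianField`, `vectorDivergence_eq_divAt_metricRep`,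
`trace_ricci_sharp_hessian_chartInv_eq`, `scalarCurvature_eq_scalAt_metricRep`,
`dalembertian_chartInv_eq`) and apply the coordinate identity
`MetricCoord.IsMetricOn.divAt_ricciHessianField`. [cite: ONeill1983, Ch. 3, Cor. 3.54] -/
theorem vectorDivergence_ricciHessianField {w : M → ℝ} (hw : CMDiff ∞ w) (x : M) :
    g.vectorDivergence (fun y ↦ (g.sharp y (g.ricci y
        (g.sharp y (mvfderiv I w y : TangentSpace I y →ₗ[ℝ] ℝ))) : TangentSpace I y)
      - (1 / 2 * g.scalarCurvature y) •
        (g.sharp y (mvfderiv I w y : TangentSpace I y →ₗ[ℝ] ℝ) : TangentSpace I y)) x =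
      g.trace x (g.ricci x ∘ₗ ((g.sharp x).toLinearMap ∘ₗ g.hessian w x))
        - 1 / 2 * g.scalarCurvature x * g.dalembertian w x := by
  -- the chart at `x`, `u₀ = φ x`, `Φ u₀ = x`
  set u₀ : chartTarget I x := ⟨extChartAt I x x, (extChartAt I x).map_source
    (mem_extChartAt_source x)⟩ with hu₀
  have hΦu₀ : chartInv I x u₀ = x := chartInv_extChartAt x (mem_chart_source H x)
  set Ĝ := metricRep I g x with hĜdef
  set wh : E → ℝ := w ∘ (extChartAt I x).symm with hwh
  have hĜ : IsMetricOn Ĝ (chartTarget I x : Set E) :=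
    isMetricOn_repr (val_chartPullback_eq_metricRep g x)
  have hT : (extChartAt I x).target ∈ 𝓝 (u₀ : E) := (isOpen_extChartAt_target x).mem_nhds u₀.2
  have hwrep : ContDiffOn ℝ ∞ wh (extChartAt I x).target := by
    rw [hwh, ← contMDiffOn_iff_contDiffOn]
    exact hw.comp_contMDiffOn (contMDiffOn_extChartAt_symm x)
  have hwa : ContDiffAt ℝ ∞ wh u₀ := hwrep.contDiffAt hT
  have hDwd : DifferentiableAt ℝ (fderiv ℝ wh) u₀ :=
    (hwa.fderiv_right (m := ∞) (by simp)).differentiableAt (by simp)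
  have h2 : (2 : ℕ∞ω) ≤ ∞ := WithTop.coe_le_coe.mpr le_top
  have hw1 : ∀ y, MDiffAt w y := fun y ↦ (hw y).mdifferentiableAt (by simp)
  have hw2 : CMDiffAt 2 w x := (hw.of_le h2) x
  -- the representative of the field and its differentiability
  set Xf : E → E := fun e ↦ sharpAt Ĝ e (ricAt Ĝ e (sharpAt Ĝ e (fderiv ℝ wh e)))
    - (1 / 2 * scalAt Ĝ e) • sharpAt Ĝ e (fderiv ℝ wh e) with hXf
  have hrep : ∀ u : chartTarget I x, vectorRep I x (fun y ↦ (g.sharp y (g.ricci y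
        (g.sharp y (mvfderiv I w y : TangentSpace I y →ₗ[ℝ] ℝ))) : TangentSpace I y)
      - (1 / 2 * g.scalarCurvature y) •
        (g.sharp y (mvfderiv I w y : TangentSpace I y →ₗ[ℝ] ℝ) : TangentSpace I y)) u = Xf u :=
    fun u ↦ vectorRep_ricciHessianField g x u (hw1 _)
  have hSd : DifferentiableAt ℝ (sharpAt Ĝ) u₀ := hĜ.differentiableAt_sharpAt u₀.2
  have hvd : DifferentiableAt ℝ (fun e ↦ sharpAt Ĝ e (fderiv ℝ wh e)) u₀ := hSd.clm_apply hDwd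
  have hscd : DifferentiableAt ℝ (scalAt Ĝ) u₀ :=
    (hĜ.contDiffOn_scalAt.contDiffAt hT).differentiableAt (by simp)
  have hXfd : DifferentiableAt ℝ Xf u₀ :=
    (hSd.clm_apply ((hĜ.differentiableAt_ricAt u₀.2).clm_apply hvd)).sub
      (((differentiableAt_const _).mul hscd).smul hvd)
  -- the field is a differentiable section at `x`
  have hXd : MDiffAt (T% (fun y ↦ (g.sharp y (g.ricci y
        (g.sharp y (mvfderiv I w y : TangentSpace I y →ₗ[ℝ] ℝ))) : TangentSpace I y)
      - (1 / 2 * g.scalarCurvature y) •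
        (g.sharp y (mvfderiv I w y : TangentSpace I y →ₗ[ℝ] ℝ) : TangentSpace I y))) x :=
    (contMDiffAt_ricciHessianField g hw x).mdifferentiableAt (by simp)
  have heq : vectorRep I x (fun y ↦ (g.sharp y (g.ricci y
        (g.sharp y (mvfderiv I w y : TangentSpace I y →ₗ[ℝ] ℝ))) : TangentSpace I y)
      - (1 / 2 * g.scalarCurvature y) •
        (g.sharp y (mvfderiv I w y : TangentSpace I y →ₗ[ℝ] ℝ) : TangentSpace I y))
      =ᶠ[𝓝 (u₀ : E)] Xf := by
    filter_upwards [(isOpen_extChartAt_target x).mem_nhds u₀.2] with e he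
    exact hrep ⟨e, he⟩
  have hXrepd : DifferentiableAt ℝ (vectorRep I x (fun y ↦ (g.sharp y (g.ricci y
        (g.sharp y (mvfderiv I w y : TangentSpace I y →ₗ[ℝ] ℝ))) : TangentSpace I y)
      - (1 / 2 * g.scalarCurvature y) •
        (g.sharp y (mvfderiv I w y : TangentSpace I y →ₗ[ℝ] ℝ) : TangentSpace I y))) u₀ :=
    hXfd.congr_of_eventuallyEq heq
  have hXd' : MDiffAt (T% (fun y ↦ (g.sharp y (g.ricci y
        (g.sharp y (mvfderiv I w y : TangentSpace I y →ₗ[ℝ] ℝ))) : TangentSpace I y)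
      - (1 / 2 * g.scalarCurvature y) •
        (g.sharp y (mvfderiv I w y : TangentSpace I y →ₗ[ℝ] ℝ) : TangentSpace I y)))
      (chartInv I x u₀) := by
    rw [hΦu₀]; exact hXd
  have hdiv := vectorDivergence_eq_divAt_metricRep g x u₀ hXd' hXrepd
  rw [hΦu₀] at hdiv
  rw [hdiv, divAt_congr_of_eventuallyEq heq]
  -- the right-hand side in the chart
  have htr := trace_ricci_sharp_hessian_chartInv_eq g x u₀ (w := w) (by rw [hΦu₀]; exact hw2)
  have hsc := scalarCurvature_eq_scalAt_metricRep g x u₀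
  have hlap := dalembertian_chartInv_eq g x u₀ (F := w) (by rw [hΦu₀]; exact hw2)
  rw [hΦu₀] at htr hsc hlap
  rw [htr, hsc, hlap, hXf]
  exact hĜ.divAt_ricciHessianField u₀.2 hDwd

omit [I.Boundaryless] in
/-- **`tr_g(Ric ∘ ♯ ∘ Hess w) = ⟨Ric, Hess w⟩_g`**: the metric trace of `Ric ∘ ♯ ∘ Hess w` is the
metric pairing `innerBilin` of the two symmetric forms (`Hess w` is symmetric,
`hessian_symm_holds`; `innerBilin S S' = tr((♯S)(♯S'ᵗ))`). [folklore] -/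
theorem trace_ricci_sharp_hessian_eq_innerBilin {w : M → ℝ} {x : M} (hw : CMDiffAt 2 w x) :
    g.trace x (g.ricci x ∘ₗ ((g.sharp x).toLinearMap ∘ₗ g.hessian w x)) =
      g.innerBilin x (g.ricci x) (g.hessian w x) := by
  have hflip : (g.hessian w x).flip = g.hessian w x :=
    LinearMap.ext fun a ↦ LinearMap.ext fun b ↦ (g.hessian_symm_holds hw).eq b a
  rw [PseudoRiemannianMetric.innerBilin, hflip]
  rfl

end Chart

/-! ### The weak contracted Bianchi identity on a closed Riemannian manifold -/

section Integral

variable {m : ℕ} {H : Type*} [TopologicalSpace H]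
  {I : ModelWithCorners ℝ (EuclideanSpace ℝ (Fin m)) H} [I.Boundaryless]
  {N : Type*} [TopologicalSpace N] [ChartedSpace H N] [IsManifold I ∞ N] [CompactSpace N]
  [T2Space N] [MeasurableSpace N] [BorelSpace N]
  (h : ContMDiffRiemannianMetric I ∞ (EuclideanSpace ℝ (Fin m)) (TangentSpace I : N → Type _))
  [(ofRiemannian h).HasLeviCivita]

/-- **The weak contracted Bianchi identity** on a closed Riemannian manifold `(N, h)` modelled on
`ℝᵐ`: for every smooth `w`,
`∫_N (⟨Ric, Hess w⟩_h − ½ R Δ_h w) dμ_h = 0`, i.e. `∫ ⟨Ric − ½Rh, Hess w⟩ dμ_h = 0` — the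
Einstein tensor is divergence free (O'Neill 1983, Ch. 3, Cor. 3.54), integrated by parts twice:
the integrand is the divergence of the smooth field `Ric(∇w, ·)♯ − ½R∇w`
(`vectorDivergence_ricciHessianField`, `trace_ricci_sharp_hessian_eq_innerBilin`), which
integrates to zero (`integral_vectorDivergence_eq_zero`). Moreover `⟨Ric, Hess w⟩_h` is
continuous. [cite: ONeill1983, Ch. 3, Cor. 3.54] -/
theorem integral_innerBilin_ricci_hessian_sub_eq_zero {w : N → ℝ} (hw : CMDiff ∞ w) :
    Continuous (fun p ↦ (ofRiemannian h).innerBilin p ((ofRiemannian h).ricci p)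
      ((ofRiemannian h).hessian w p)) ∧
    ∫ p, ((ofRiemannian h).innerBilin p ((ofRiemannian h).ricci p) ((ofRiemannian h).hessian w p)
      - 1 / 2 * (ofRiemannian h).scalarCurvature p * (ofRiemannian h).dalembertian w p)
        ∂riemannianMeasure h = 0 := by
  set g := ofRiemannian h with hg
  have h1 : (1 : ℕ∞ω) ≤ ∞ := WithTop.coe_le_coe.mpr le_top
  have h2 : (2 : ℕ∞ω) ≤ ∞ := WithTop.coe_le_coe.mpr le_top
  have hW : CMDiff 1 (T% (fun y ↦ (g.sharp y (g.ricci y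
        (g.sharp y (mvfderiv I w y : TangentSpace I y →ₗ[ℝ] ℝ))) : TangentSpace I y)
      - (1 / 2 * g.scalarCurvature y) •
        (g.sharp y (mvfderiv I w y : TangentSpace I y →ₗ[ℝ] ℝ) : TangentSpace I y))) := fun x ↦
    (contMDiffAt_ricciHessianField g hw x).of_le h1
  obtain ⟨hc, h0⟩ := integral_vectorDivergence_eq_zero h hW
  have hw2 : ∀ p, CMDiffAt 2 w p := fun p ↦ (hw.of_le h2) p
  have heq : g.vectorDivergence (fun y ↦ (g.sharp y (g.ricci y
        (g.sharp y (mvfderiv I w y : TangentSpace I y →ₗ[ℝ] ℝ))) : TangentSpace I y)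
      - (1 / 2 * g.scalarCurvature y) •
        (g.sharp y (mvfderiv I w y : TangentSpace I y →ₗ[ℝ] ℝ) : TangentSpace I y)) =
      fun p ↦ g.innerBilin p (g.ricci p) (g.hessian w p)
        - 1 / 2 * g.scalarCurvature p * g.dalembertian w p :=
    funext fun p ↦ by
      rw [vectorDivergence_ricciHessianField g hw p, trace_ricci_sharp_hessian_eq_innerBilin g (hw2 p)]
  rw [heq] at h0 hc
  refine ⟨?_, h0⟩
  -- continuity of the pairing: the divergence is continuous and so is `R Δw`
  have hRΔ : Continuous fun p ↦ 1 / 2 * g.scalarCurvature p * g.dalembertian w p :=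
    (continuous_const.mul g.contMDiff_scalarCurvature.continuous).mul
      (continuous_dalembertian g (hw.of_le h2))
  convert hc.add hRΔ using 1
  funext p
  simp only [Pi.add_apply]
  ring

/-- **The weak contracted Bianchi identity, `2⟨Ric, Hess w⟩ − RΔw` form**: on a closed
Riemannian manifold, `∫_N (2⟨Ric, Hess w⟩_h − R Δ_h w) dμ_h = 0` for every smooth `w` (twice
`integral_innerBilin_ricci_hessian_sub_eq_zero`). This is the hypothesis `hBianchi` of
`sigma2WeylSchoutenIntegral_conformal_exp_of_bianchiPairing` (`Sigma2ConformalFour.lean`).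
[cite: ONeill1983, Ch. 3, Cor. 3.54] -/
theorem integral_two_mul_innerBilin_ricci_hessian_sub_eq_zero {w : N → ℝ} (hw : CMDiff ∞ w) :
    ∫ p, (2 * (ofRiemannian h).innerBilin p ((ofRiemannian h).ricci p) ((ofRiemannian h).hessian w p)
      - (ofRiemannian h).scalarCurvature p * (ofRiemannian h).dalembertian w p)
        ∂riemannianMeasure h = 0 := by
  have h0 := (integral_innerBilin_ricci_hessian_sub_eq_zero h hw).2
  have heq : (fun p ↦ 2 * (ofRiemannian h).innerBilin p ((ofRiemannian h).ricci p)
      ((ofRiemannian h).hessian w p)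
      - (ofRiemannian h).scalarCurvature p * (ofRiemannian h).dalembertian w p) =
      fun p ↦ 2 * ((ofRiemannian h).innerBilin p ((ofRiemannian h).ricci p)
        ((ofRiemannian h).hessian w p)
        - 1 / 2 * (ofRiemannian h).scalarCurvature p * (ofRiemannian h).dalembertian w p) := by
    funext p
    ring
  rw [heq, integral_const_mul, h0, mul_zero]

/-- **`∫ ⟨Ric, Hess w⟩ dμ_h = ½ ∫ R Δ_h w dμ_h`** on a closed Riemannian manifold, for smooth `w`
(`integral_innerBilin_ricci_hessian_sub_eq_zero`; both integrands are continuous).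
[cite: ONeill1983, Ch. 3, Cor. 3.54] -/
theorem integral_innerBilin_ricci_hessian_eq {w : N → ℝ} (hw : CMDiff ∞ w) :
    ∫ p, (ofRiemannian h).innerBilin p ((ofRiemannian h).ricci p) ((ofRiemannian h).hessian w p)
        ∂riemannianMeasure h =
      1 / 2 * ∫ p, (ofRiemannian h).scalarCurvature p * (ofRiemannian h).dalembertian w p
        ∂riemannianMeasure h := by
  obtain ⟨hc, h0⟩ := integral_innerBilin_ricci_hessian_sub_eq_zero h hw
  have h2 : (2 : ℕ∞ω) ≤ ∞ := WithTop.coe_le_coe.mpr le_top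
  have hRΔ : Continuous fun p ↦ (ofRiemannian h).scalarCurvature p *
      (ofRiemannian h).dalembertian w p :=
    (ofRiemannian h).contMDiff_scalarCurvature.continuous.mul
      (continuous_dalembertian (ofRiemannian h) (hw.of_le h2))
  have i1 := integrable_of_continuous h hc
  have i2 : Integrable (fun p ↦ 1 / 2 * (ofRiemannian h).scalarCurvature p *
      (ofRiemannian h).dalembertian w p) (riemannianMeasure h) := by
    have := (integrable_of_continuous h hRΔ).const_mul (1 / 2)
    refine this.congr (Eventually.of_forall fun p ↦ ?_)
    simp only [mul_assoc]
  rw [integral_sub i1 i2] at h0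
  have h3 : ∫ p, 1 / 2 * (ofRiemannian h).scalarCurvature p * (ofRiemannian h).dalembertian w p
      ∂riemannianMeasure h = 1 / 2 * ∫ p, (ofRiemannian h).scalarCurvature p *
        (ofRiemannian h).dalembertian w p ∂riemannianMeasure h := by
    rw [← integral_const_mul]
    refine integral_congr_ae (Eventually.of_forall fun p ↦ ?_)
    simp only [mul_assoc]
  linarith

end Integral

end Literature.Geometry.Riemannian

end
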